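import Literature.NumberTheory.EllipticCurves.ModularPolynomialLevelTwo
import Literature.NumberTheory.EllipticCurves.GrossZagierSingularModuliClassNumberOne
import Literature.NumberTheory.EllipticCurves.ModularPolynomialLevelThreeDiscriminant
import HarnessLib

/-!
# The class polynomial of discriminant `-48`: `H_{-48}(X) = X² − 2835810000·X + 6549518250000`, read off the level-2 fibre over `j(√-3) = 54000`

Topic `NumberTheory/EllipticCurves` (singular moduli).  Theorem-only file (no definition, no named fact).
Discriminant `-48` (= `16·(-3)` = `4·(-12)`) has class number 2 with reduced forms `(1, 0, 12)`, `(3, 0, 4)`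
(Cox Thm. 2.13); its class polynomial and the singular modulus `j(2√-3) = 1417905000 + 818626500√3` are PRINTED in
N. Ishii, Bull. Austral. Math. Soc. 70 (2004) = arXiv:math/0401289, §3 (tables of class equations, prepared with
M. Kaneko's tables), row `d(R) = -48`.

## Method — pure polynomial algebra on the explicit `Φ₂` (`ModularPolynomialLevelTwo.lean`)

For `τ = τ_{(1, 0, 3)} = √-3` (`j(τ) = 54000`, Cox (12.20), order of discriminant `-12`) the three level-2 conjugates
are `2τ = τ_{(1, 0, 12)}`, `τ/2 = τ_{(4, 0, 3)} ∼ τ_{(3, 0, 4)}` (the two classes of discriminant `-48`) and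
`(τ + 1)/2 = τ_{(4, -4, 4)} = τ_{(1, -1, 1)} ∼ τ_{(1, 1, 1)}` (`j = 0`).  Comparing the fibre identity
`Φ₂(x, 54000) = (x − j(2τ))(x − j(τ/2))(x − j((τ+1)/2))` (Cox (11.14)–(11.15)) with the explicit integer polynomial
`Φ₂(x, 54000)` at `x = 1, −1` gives trace and norm of the two singular moduli of discriminant `-48` by
`linear_combination` — no size estimate, no discriminant —, hence `classPolynomial (-48)`; the size window
`10⁹ ≤ |j(τ_{(1,0,12)})| ≤ 10¹⁰` (`= e^{π√48} ± 784`) then picks the printed root.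

## References

* [Ishii2004] N. Ishii, *Trace of Frobenius endomorphism of an elliptic curve with complex multiplication*,
  Bull. Austral. Math. Soc. 70 (2004) 125–142 (= arXiv:math/0401289), §3 table `h(R) = 2`, row `d(R) = -48`.
* [Cox2013] D. A. Cox, *Primes of the form x² + ny²*, 2nd ed., Thm. 2.13, §11.B (11.14)–(11.15), §12.C (12.20), §13.A Prop. 13.11.
* [GranvilleStark2000] A. Granville, H. M. Stark, Invent. Math. 139 (2000), §2 (the size of `j(τ)`).
-/

noncomputable section

open Complex Polynomial
open UpperHalfPlane hiding I
open scoped Real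

namespace Literature.NumberTheory.EllipticCurves

open ModularForms ModularPolynomialTwo GrossZagier1985
open Literature.NumberTheory.QuadraticFields.BinaryQuadraticForm (reducedForms principalForm)
open Literature.NumberTheory.QuadraticFields.Quadratic (BinQF)

namespace ClassPolynomialNegFortyEight

/-! ### §1 The three level-2 conjugates of `τ_{(1, 0, 3)}` -/

/-- Scaling a form by `2` does not move its CM point: `τ_{(2a, 2b, 2c)} = τ_{(a, b, c)}` (a private copy of the
private lemma of `ModularPolynomialLevelTwo.lean`). [folklore] -/
private theorem heegnerTau_scale_two {a b c : ℤ} (ha : 0 < a) (hD : b ^ 2 - 4 * a * c < 0) :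
    heegnerTau (2 * a, 2 * b, 2 * c) = heegnerTau (a, b, c) := by
  have ha0 : (a : ℂ) ≠ 0 := by exact_mod_cast ha.ne'
  apply UpperHalfPlane.ext
  rw [coe_heegnerTau_eq (Q := (2 * a, 2 * b, 2 * c)) (D := 4 * (b ^ 2 - 4 * a * c)) (by simp only; linarith)
      (by simp only; ring) (by linarith),
    coe_heegnerTau_eq (Q := (a, b, c)) (D := b ^ 2 - 4 * a * c) ha rfl hD, sqrtDisc_four_mul]
  push_cast
  field_simp

/-- `j(2τ) = j(τ_{(1, 0, 12)})` for `τ = τ_{(1, 0, 3)}`. [cite: Cox2013, §11.B (11.14)–(11.15)] -/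
theorem kleinJ_mulPoint_two : kleinJ (mulPoint 2 (heegnerTau (1, 0, 3))) = formJ (1, 0, 12) := by
  have h := mulPoint_two_heegnerTau (a := 1) (b := 0) (c := 3) one_pos (by norm_num)
  norm_num at h
  rw [h, ← formJ_eq_kleinJ]

/-- `j(τ/2) = j(τ_{(4, 0, 3)}) = j(τ_{(3, 0, 4)})` for `τ = τ_{(1, 0, 3)}`. [cite: Cox2013, §11.A Thm. 11.2 and Exercise 11.5] -/
theorem kleinJ_divPoint_two_zero : kleinJ (divPoint 2 0 (heegnerTau (1, 0, 3))) = formJ (3, 0, 4) := by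
  have h := divPoint_two_zero_heegnerTau (a := 1) (b := 0) (c := 3) one_pos (by norm_num)
  norm_num at h
  rw [h, ← formJ_eq_kleinJ, formJ_eq_formJ_flip (a := 4) (b := 0) (c := 3) (by norm_num) (by norm_num)]
  norm_num

/-- `j((τ + 1)/2) = j(τ_{(4, -4, 4)}) = j(τ_{(1, -1, 1)}) = j(τ_{(1, 1, 1)}) = 0` for `τ = τ_{(1, 0, 3)}`.
[cite: Cox2013, §12.C table (12.20)] -/
theorem kleinJ_divPoint_two_one : kleinJ (divPoint 2 1 (heegnerTau (1, 0, 3))) = 0 := by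
  have h := divPoint_two_heegnerTau (a := 1) (b := 0) (c := 3) one_pos (by norm_num) 1
  norm_num at h
  rw [h, show ((4 : ℤ), (-4 : ℤ), (4 : ℤ)) = (2 * 2, 2 * (-2), 2 * 2) by norm_num,
    heegnerTau_scale_two (by norm_num) (by norm_num),
    show ((2 : ℤ), (-2 : ℤ), (2 : ℤ)) = (2 * 1, 2 * (-1), 2 * 1) by norm_num,
    heegnerTau_scale_two (by norm_num) (by norm_num), ← formJ_eq_kleinJ,
    formJ_one_eq_of_discr_eq (B := -1) (C := 1) (B' := 1) (C' := 1) (by norm_num) (by norm_num),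
    formJ_eq_kleinJ, kleinJ_heegnerTau_neg_three]

/-! ### §2 The fibre of `Φ₂` over `54000` -/

/-- **The level-2 fibre over `j(τ_{(1, 0, 3)}) = 54000`: `Φ₂(x, 54000) = (x − j(τ_{(1,0,12)}))·(x − j(τ_{(3,0,4)}))·x`.**
[cite: Cox2013, §11.B (11.14)–(11.15); §13.A Prop. 13.11] -/
theorem fiber (x : ℂ) :
    x ^ 3 + 54000 ^ 3 - x ^ 2 * 54000 ^ 2 + 1488 * (x ^ 2 * 54000 + x * 54000 ^ 2) - 162000 * (x ^ 2 + 54000 ^ 2) +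
        40773375 * x * 54000 + 8748000000 * (x + 54000) - 157464000000000 =
      (x - formJ (1, 0, 12)) * ((x - formJ (3, 0, 4)) * (x - 0)) := by
  have h := eval_kleinJ_eq_prod x (heegnerTau (1, 0, 3))
  rw [intModularPolynomial_two_eval, kleinJ_heegnerTau_neg_twelve, kleinJ_mulPoint_two, kleinJ_divPoint_two_zero,
    kleinJ_divPoint_two_one] at h
  exact h

/-! ### §3 The elementary symmetric functions of the singular moduli of discriminant `-48` -/

/-- Trace: `j(τ_{(1, 0, 12)}) + j(τ_{(3, 0, 4)}) = 2835810000`. [cite: Ishii2004, §3 table h(R) = 2, row d(R) = −48 (`x² − 2835810000x + 6549518250000`)] -/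
theorem formJ_add : formJ (1, 0, 12) + formJ (3, 0, 4) = 2835810000 := by
  have h1 := fiber 1
  have hm1 := fiber (-1)
  linear_combination (1 / 2 : ℂ) * h1 + (1 / 2 : ℂ) * hm1

/-- Norm: `j(τ_{(1, 0, 12)}) · j(τ_{(3, 0, 4)}) = 6549518250000`. [cite: Ishii2004, §3 table h(R) = 2, row d(R) = −48 (`x² − 2835810000x + 6549518250000`)] -/
theorem formJ_mul : formJ (1, 0, 12) * formJ (3, 0, 4) = 6549518250000 := by
  have h1 := fiber 1
  have hm1 := fiber (-1)
  linear_combination (-1 / 2 : ℂ) * h1 + (1 / 2 : ℂ) * hm1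

end ClassPolynomialNegFortyEight

open ClassPolynomialNegFortyEight

/-! ### §4 The class polynomial `H_{-48}` -/

/-- **`H_{-48}(X) = X² − 2835810000·X + 6549518250000`**: the class polynomial of discriminant `-48` (reduced forms
`(1, 0, 12)`, `(3, 0, 4)`) as a kernel theorem about the tree's `classPolynomial (-48)`.
[cite: Ishii2004, §3 table h(R) = 2, row d(R) = −48 (`x² − 2835810000x + 6549518250000`)] -/
theorem classPolynomial_neg_fortyEight :
    classPolynomial (-48) = X ^ 2 - C (2835810000 : ℂ) * X + C (6549518250000 : ℂ) := by
  have hred : reducedForms (-48) = {((1 : ℤ), (0 : ℤ), (12 : ℤ)), (3, 0, 4)} := by decide +kernel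
  rw [classPolynomial, hred, Finset.prod_pair (by decide)]
  calc (X - C (formJ (1, 0, 12))) * (X - C (formJ (3, 0, 4)))
      = X ^ 2 - C (formJ (1, 0, 12) + formJ (3, 0, 4)) * X + C (formJ (1, 0, 12) * formJ (3, 0, 4)) := by
        rw [C_add, C_mul]; ring
    _ = X ^ 2 - C (2835810000 : ℂ) * X + C (6549518250000 : ℂ) := by
        rw [formJ_add, formJ_mul]

/-- `H_{-48}(x) = x ^ 2 - 2835810000 · x + 6549518250000` for every `x ∈ ℂ`. [cite: Ishii2004, §3 table h(R) = 2, row d(R) = −48 (`x² − 2835810000x + 6549518250000`)] -/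
theorem classPolynomial_neg_fortyEight_eval (x : ℂ) :
    (classPolynomial (-48)).eval x = x ^ 2 - 2835810000 * x + 6549518250000 := by
  rw [classPolynomial_neg_fortyEight]
  simp only [eval_add, eval_sub, eval_mul, eval_pow, eval_X, eval_C]

namespace ClassPolynomialNegFortyEight

/-! ### §5 The explicit singular moduli (the size window picks the root) -/

/-- `21 ≤ π√48 ≤ 22`. [folklore] -/
private theorem pi_mul_sqrt_bounds : (21 : ℝ) ≤ π * √(48 : ℝ) ∧ π * √(48 : ℝ) ≤ 22 := by
  have hs1 : (6.9 : ℝ) < √(48 : ℝ) := (Real.lt_sqrt (by norm_num)).mpr (by norm_num)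
  have hs2 : √(48 : ℝ) < 7 := (Real.sqrt_lt' (by norm_num)).mpr (by norm_num)
  have hπ1 : (3.1415 : ℝ) < π := Real.pi_gt_d4
  have hπ2 : π < 3.1416 := Real.pi_lt_d4
  constructor <;> nlinarith

/-- `10 ^ 9 + 784 ≤ e^{21}` and `e^{22} ≤ 10 ^ 10 − 784`. [folklore] -/
private theorem exp_bounds : (10 ^ 9 + 784 : ℝ) ≤ Real.exp 21 ∧ Real.exp 22 ≤ 10 ^ 10 - 784 := by
  have h1 : (2.7182818283 : ℝ) < Real.exp 1 := Real.exp_one_gt_d9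
  have h2 : Real.exp 1 < 2.7182818286 := Real.exp_one_lt_d9
  have e1 : Real.exp 21 = Real.exp 1 ^ 21 := by rw [← Real.exp_nat_mul]; norm_num
  have e2 : Real.exp 22 = Real.exp 1 ^ 22 := by rw [← Real.exp_nat_mul]; norm_num
  rw [e1, e2]
  constructor
  · have h3 : (10 ^ 9 + 784 : ℝ) ≤ (2.7182818283 : ℝ) ^ 21 := by norm_num
    exact h3.trans (pow_le_pow_left₀ (by norm_num) h1.le 21)
  · have h3 : (2.7182818286 : ℝ) ^ 22 ≤ 10 ^ 10 - 784 := by norm_num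
    exact (pow_le_pow_left₀ (Real.exp_pos 1).le h2.le 22).trans h3

/-- **`10 ^ 9 ≤ |j(τ_{(1, 0, 12)})| ≤ 10 ^ 10`** (`|j(τ_P)| = e^{π√48} ± 784`). [cite: GranvilleStark2000, §2] -/
theorem norm_bounds : (10 ^ 9 : ℝ) ≤ ‖formJ (1, 0, 12)‖ ∧ ‖formJ (1, 0, 12)‖ ≤ 10 ^ 10 := by
  have hP : principalForm (-48) = ((1 : ℤ), (0 : ℤ), (12 : ℤ)) := by decide
  obtain ⟨hlo, hhi⟩ := pi_mul_sqrt_bounds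
  obtain ⟨elo, ehi⟩ := exp_bounds
  have hXlo : (10 ^ 9 + 784 : ℝ) ≤ Real.exp (π * √(48 : ℝ)) := elo.trans (Real.exp_le_exp.mpr hlo)
  have hXhi : Real.exp (π * √(48 : ℝ)) ≤ 10 ^ 10 - 784 := (Real.exp_le_exp.mpr hhi).trans ehi
  have hX4 : (10 ^ 4 : ℝ) ≤ Real.exp (π * √(-((-48 : ℤ) : ℝ))) := by
    have h' := hXlo
    norm_num at h' ⊢
    linarith
  have h := abs_norm_formJ_principalForm_sub_exp_le (D := -48) (by norm_num) (by norm_num) hX4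
  rw [hP] at h
  norm_num at h hXlo hXhi
  rw [abs_le] at h
  constructor <;> linarith [h.1, h.2]

/-- `j_A² − 2835810000·j_A + 6549518250000 = 0` (from trace and norm). [cite: Ishii2004, §3 table h(R) = 2, row d(R) = −48 (`x² − 2835810000x + 6549518250000`)] -/
theorem formJ_isRoot : formJ (1, 0, 12) ^ 2 - 2835810000 * formJ (1, 0, 12) + 6549518250000 = 0 := by
  have hs := formJ_add
  have hp := formJ_mul
  linear_combination (formJ (1, 0, 12)) * hs - hp

/-- `(√3)² = 3` in `ℂ`. [folklore] -/
private theorem sqrt_sq : ((√(3 : ℝ) : ℂ)) ^ 2 = 3 := by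
  rw [← Complex.ofReal_pow, Real.sq_sqrt (by norm_num)]; norm_num

/-- **`j(2√-3) = j(τ_{(1, 0, 12)}) = 1417905000 + 818626500 * √3`** (the root inside the size window; the other root
`≈ 2309.6` is excluded). [cite: Ishii2004, §3 table h(R) = 2, row d(R) = −48 (`j = 1417905000 + 818626500√3`)] -/
theorem formJ_eq : formJ (1, 0, 12) = 1417905000 + 818626500 * (√(3 : ℝ) : ℂ) := by
  have hH := formJ_isRoot
  have hsq : (formJ (1, 0, 12) - 1417905000) ^ 2 = (818626500 * (√(3 : ℝ) : ℂ)) ^ 2 := by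
    linear_combination hH - (818626500 ^ 2 : ℂ) * sqrt_sq
  rcases sq_eq_sq_iff_eq_or_eq_neg.mp hsq with h | h
  · linear_combination h
  · exfalso
    have hj : formJ (1, 0, 12) = ((1417905000 - 818626500 * √(3 : ℝ) : ℝ) : ℂ) := by
      push_cast
      linear_combination h
    obtain ⟨hlo, -⟩ := norm_bounds
    rw [hj, Complex.norm_real, Real.norm_eq_abs] at hlo
    have hs1 : (1.732 : ℝ) < √(3 : ℝ) := (Real.lt_sqrt (by norm_num)).mpr (by norm_num)
    have hs2 : √(3 : ℝ) < 1.7321 := (Real.sqrt_lt' (by norm_num)).mpr (by norm_num)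
    have hlt : |(1417905000 - 818626500 * √(3 : ℝ) : ℝ)| < 10 ^ 9 := by
      rw [abs_lt]; constructor <;> linarith
    linarith

/-- **`j(τ_{(3, 0, 4)}) = 1417905000 - 818626500 * √3`.** [cite: Ishii2004, §3 table h(R) = 2, row d(R) = −48 (`x² − 2835810000x + 6549518250000`, `j = 1417905000 + 818626500√3`)] -/
theorem formJ_other_eq : formJ (3, 0, 4) = 1417905000 - 818626500 * (√(3 : ℝ) : ℂ) := by
  have hs := formJ_add
  have h := formJ_eq
  linear_combination hs - h

/-- `j(𝒪_{-48}) = j(2√-3) = 1417905000 + 818626500 * √3` for the tree's lattice `cmPeriodPair (-48)`.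
[cite: Ishii2004, §3 table h(R) = 2, row d(R) = −48 (`j = 1417905000 + 818626500√3`)] -/
theorem j_cmPeriodPair : (cmPeriodPair (-48)).j = 1417905000 + 818626500 * (√(3 : ℝ) : ℂ) := by
  have hP : principalForm (-48) = ((1 : ℤ), (0 : ℤ), (12 : ℤ)) := by decide
  rw [← formJ_principalForm (D := -48) (by norm_num) (by norm_num), hP, formJ_eq]

end ClassPolynomialNegFortyEight

end Literature.NumberTheory.EllipticCurves

end
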